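import Literature.Analysis.FluidPDE.TaoCascadeEquationsOfMotion
import Literature.Analysis.FluidPDE.TaoCascadeBlowupDynamicsCorrected
import HarnessLib

/-!
# Tao's averaged Navier–Stokes blow-up: Theorem 3.3 (blowup for a local cascade equation) from the §6 dynamics

T. Tao, *Finite time blowup for an averaged three-dimensional Navier–Stokes equation*,
J. Amer. Math. Soc. **29** (2016), 601–674 = arXiv:1402.0290v3 (held as `paper:arxiv-1402.0290`):
Theorem 3.3 (p. 14) is proved in §4 (pp. 21–23: Thm 3.3 ⇐ Lemma 4.1 + Thm 4.2), §5 and §6.1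
(Thm 4.2 ⇐ Thm 6.2, p. 31) and §6.2–6.7 (Thm 6.2 ⇐ Prop. 6.3 (p. 31) ⇐ Prop. 6.4 ⇐ Prop. 6.5 ⇐
Prop. 6.12 (p. 36)); page numbers of arXiv v3.

Proof file for the named fact `localCascade_blowup` (`TaoAveragedCascade.lean`). With Lemma 4.1
discharged (`equationsOfMotion_holds`, `TaoCascadeEquationsOfMotion.lean`) and the accepted reductions
`TaoCascade.odeBlowup_of_noGlobalODESolution` (Thm 4.2 ⇐ Thm 6.2), `TaoCascade.noGlobalODESolution_of_blowupDynamics`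
/ `…_of_blowupDynamicsWith` (Thm 6.2 ⇐ Prop. 6.3, printed and corrected coefficient) and
`TaoCascade.blowupDynamicsCorrected_of_reducedClaimCorrected` (Prop. 6.3 ⇐ Prop. 6.12, §6.3–6.5),
Theorem 3.3 is reduced here, by composition, to each of the remaining named facts of §6:

* `localCascade_blowup_of_blowupDynamics` — Thm 3.3 ⇐ Prop. 6.3 as printed (`TaoCascade.blowupDynamics`);
* `localCascade_blowup_of_blowupDynamicsCorrected` — Thm 3.3 ⇐ Prop. 6.3 with the author-corrected
  coefficient `10⁻⁵e^{-K¹⁰/2}` in (6.17) (`TaoCascade.blowupDynamicsCorrected`);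
* `localCascade_blowup_of_reducedClaimCorrected` — Thm 3.3 ⇐ Prop. 6.12 (reduced induction claim,
  corrected coefficient; `TaoCascade.reducedClaimCorrected`), the statement proved in §6.6–6.7.

Also `averagedNS_blowup_of_isAveraged_of_reducedClaimCorrected` (Thm 1.5 ⇐ Thm 3.2 + Prop. 6.12). The
unconditional `localCascade_blowup_holds` is the one-line consequence of any of these once the
corresponding §6 fact is discharged.

## References

* T. Tao, J. Amer. Math. Soc. 29 (2016), 601–674, arXiv:1402.0290v3, Thm. 3.3; §4 pp. 21–23; §6.1 Thm. 6.2;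
  §6.2 Prop. 6.3; §6.5 Prop. 6.12. Key `Tao2016AveragedNS`.
-/

namespace Literature.Analysis.FluidPDE.Tao2016

/-- **Theorem 3.3 ⇐ Proposition 6.3 (as printed).** [cite: Tao2016AveragedNS, §4, §6.1–6.2] -/
theorem localCascade_blowup_of_blowupDynamics (h : TaoCascade.blowupDynamics) : localCascade_blowup :=
  localCascade_blowup_of_noGlobalODESolution (TaoCascade.noGlobalODESolution_of_blowupDynamics h)

/-- **Theorem 3.3 ⇐ Proposition 6.3 with the corrected coefficient in (6.17).**
[cite: Tao2016AveragedNS, §4, §6.1–6.2] -/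
theorem localCascade_blowup_of_blowupDynamicsCorrected (h : TaoCascade.blowupDynamicsCorrected) :
    localCascade_blowup :=
  localCascade_blowup_of_noGlobalODESolution (TaoCascade.noGlobalODESolution_of_blowupDynamicsWith h)

/-- **Theorem 3.3 ⇐ Proposition 6.12 (reduced induction claim, corrected coefficient)** — the whole
reduction chain of §§4–6.5 composed: a proof of Prop. 6.12 (§6.6–6.7) closes Theorem 3.3.
[cite: Tao2016AveragedNS, §4, §6.1–6.5] -/
theorem localCascade_blowup_of_reducedClaimCorrected (h : TaoCascade.reducedClaimCorrected) :
    localCascade_blowup :=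
  localCascade_blowup_of_blowupDynamicsCorrected (TaoCascade.blowupDynamicsCorrected_of_reducedClaimCorrected h)

/-- **Theorem 1.5 ⇐ Theorem 3.2 + Proposition 6.12 (corrected coefficient)**: with Lemma 4.1 and the
§4–§6.5 reductions in place, the averaged Navier–Stokes blow-up `averagedNS_blowup` needs exactly the
two remaining named facts `localCascade_isAveraged` (Thm 3.2, §5) and `TaoCascade.reducedClaimCorrected`
(Prop. 6.12, §6.6–6.7). [cite: Tao2016AveragedNS, Thm. 1.5, §3–§6] -/
theorem averagedNS_blowup_of_isAveraged_of_reducedClaimCorrected (h32 : localCascade_isAveraged)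
    (h612 : TaoCascade.reducedClaimCorrected) : averagedNS_blowup :=
  averagedNS_blowup_of_isAveraged_of_noGlobalODESolution h32
    (TaoCascade.noGlobalODESolution_of_blowupDynamicsWith
      (TaoCascade.blowupDynamicsCorrected_of_reducedClaimCorrected h612))

end Literature.Analysis.FluidPDE.Tao2016
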